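import Summits.Ventures.YMGap.RobustBall.StringTensionSharp
import HarnessLib

/-!
# Robust ball (Y2), area-law side — the static quark potential and the plaquette for EVERY `SU(N)`: explicit two-sided bounds

HONEST FRAMING: venture file of the cell `pub-ymgap` (QuantumFields programme), track ROBUST-BALL, seat rb-p2 (g5).  LATTICE
statements about the infinite-volume limit states of the `SU(N)` torus Wilson states at tree coupling `β` (`= β_W/N`), dimension
`n + 1 ≥ 2`; `V_μ(R) = staticPotential μ χ_N R` and `W_μ(1,1)` exist / are positive at every `β > 0` (rb-p2 g3).  WHAT IS NEW
(every `N ≥ 2`, from the exact character variance `V₀ ≥ 1/2` of `HaarSecondMoments` and the Bakry–Émery one-link modulus):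
* the PLAQUETTE: `W_μ(1,1) ≥ β e^{−8nNβ}/(4nN)` at every `β > 0` (`suN_rectExpectation_one_one_ge`; SU(2): `β_W e^{−8nβ_W}/(8n)`);
* the POTENTIAL, ceiling (Seiler's «not faster than linear» made numerical): `V_μ(R) ≤ (log(4nN/β) + 8nNβ)·R` for every `R`
  at every `β > 0` (`suN_staticPotential_le_linear`);
* the POTENTIAL, floor on the 't Hooft window `R_s = 2nβ/N ≤ 1/4`:
  `V_μ(R) ≥ log((1/2 − R_s)/R_s)·R − 2·log(32N³(1/2 − R_s)/R_s)` for `R ≥ 1` (`suN_staticPotential_ge`);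
* `d = 4`, every `N`, `0 < β ≤ N/24`, `R ≥ 1`: `(log(N/β) − log 24)·R − 2·log(8N⁴/(3β)) ≤ V_μ(R) ≤ (log(N/β) + log 12 + 24Nβ)·R`
  (`suN_staticPotential_two_sided_dim4`) — THE STATIC QUARK POTENTIAL OF EVERY `SU(N)` IS LINEAR UP TO CERTIFIED CONSTANTS.
WHAT IT IS NOT: constants are door / one-link artefacts; nothing continuum / spectral / Clay.

References: E. Seiler, Phys. Rev. D 18 (1978) 482 and LNP 159 (1982) §2; K. Wilson, Phys. Rev. D 10 (1974) 2445.  Everything here is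
proved. [folklore]
-/

noncomputable section

open MeasureTheory Filter Topology
open Literature.MathematicalPhysics.QuantumLattice
open Literature.MathematicalPhysics.QuantumFieldTheory hiding ZdEdge Site

namespace Summit.Ventures.YMGap.RobustBall

namespace StringTensionExplicit

variable {n N : ℕ}

/-! ### The plaquette expectation for every `N` -/

/-- **Every `N ≥ 2`, dimension `n + 1 ≥ 2`, every `β > 0`: `W_μ(1,1) ≥ β e^{−8nNβ}/(4nN)`** for every infinite-volume limit state
(rb-p2 g3's `PlaquettePositivity.rectExpectation_one_one_ge` with `V₀ ≥ 1/2`). [folklore] -/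
theorem suN_rectExpectation_one_one_ge (hN : 2 ≤ N) (hn : 1 ≤ n) {β : ℝ} (hβ : 0 < β) {μ : Measure (LGConfig (n + 1) (SUN N))}
    (hμ : haveI : NeZero (n + 1) := ⟨by omega⟩; μ ∈ infiniteVolumeLimitPoints (fundamentalRep (Fin N)) β) :
    haveI : NeZero (n + 1) := ⟨by omega⟩
    β * Real.exp (-(8 * n * N * β)) / (4 * n * N) ≤
      rectExpectation μ (fun g => normalisedCharacter N (fundamentalRep (Fin N) g)) 0 1 1 1 := by
  haveI : NeZero (n + 1) := ⟨by omega⟩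
  have hρ := TorusAreaLaw.isSpecialUnitaryModel_fundamentalRep N
  have h := PlaquettePositivity.rectExpectation_one_one_ge (d := n + 1) (fundamentalRep (Fin N)) hρ hN (by omega) hβ.le hμ
  have hV := HaarSecondMoments.half_le_charVariance (fundamentalRep (Fin N)) hρ hN
  have hd : ((n + 1 : ℕ) : ℝ) - 1 = n := by push_cast; ring
  rw [hd] at h
  have hN0 : (0 : ℝ) < N := by exact_mod_cast (show 0 < N by omega)
  have hn0 : (0 : ℝ) < n := by exact_mod_cast (show 0 < n by omega)
  refine le_trans ?_ h
  have hE : 0 ≤ β * Real.exp (-(8 * (n : ℝ) * N * β)) := by positivity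
  calc β * Real.exp (-(8 * (n : ℝ) * N * β)) / (4 * n * N)
      = β * Real.exp (-(8 * (n : ℝ) * N * β)) * (1 / 2) / (2 * n * N) := by field_simp; ring
    _ ≤ β * Real.exp (-(8 * (n : ℝ) * N * β)) * PlaquetteLowerBound.charVariance (fundamentalRep (Fin N)) / (2 * n * N) :=
        div_le_div_of_nonneg_right (mul_le_mul_of_nonneg_left hV hE) (by positivity)

/-- **SU(2), dimension `n + 1 ≥ 2`, every `β_W > 0`: `W_μ(1,1) ≥ β_W e^{−8nβ_W}/(8n)`** (tree coupling `β_W/2`, `V₀ = 1`). [folklore] -/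
theorem su2_rectExpectation_one_one_ge (hn : 1 ≤ n) {βW : ℝ} (hβ : 0 < βW) {μ : Measure (LGConfig (n + 1) (SUN 2))}
    (hμ : haveI : NeZero (n + 1) := ⟨by omega⟩; μ ∈ infiniteVolumeLimitPoints (fundamentalRep (Fin 2)) (βW / 2)) :
    haveI : NeZero (n + 1) := ⟨by omega⟩
    βW * Real.exp (-(8 * n * βW)) / (8 * n) ≤
      rectExpectation μ (fun g => normalisedCharacter 2 (fundamentalRep (Fin 2) g)) 0 1 1 1 := by
  haveI : NeZero (n + 1) := ⟨by omega⟩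
  have hρ := TorusAreaLaw.isSpecialUnitaryModel_fundamentalRep 2
  have h := PlaquettePositivity.rectExpectation_one_one_ge (d := n + 1) (fundamentalRep (Fin 2)) hρ le_rfl (by omega)
    (by positivity : (0 : ℝ) ≤ βW / 2) hμ
  rw [HaarSecondMoments.charVariance_su2] at h
  have hd : ((n + 1 : ℕ) : ℝ) - 1 = n := by push_cast; ring
  rw [hd] at h
  have hn0 : (0 : ℝ) < n := by exact_mod_cast (show 0 < n by omega)
  refine le_trans (le_of_eq ?_) h
  push_cast
  field_simp
  ring_nf

/-! ### The static potential for every `N`: ceiling at every coupling, floor on the 't Hooft window -/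

/-- **Every `N ≥ 2`, dimension `n + 1 ≥ 2`, every `β > 0`, every `R`: `V_μ(R) ≤ (log(4nN/β) + 8nNβ)·R`** for every infinite-volume
limit state (Seiler: `V(R) ≤ R·V(1) ≤ R·(−log W(1,1))`, and the every-`N` plaquette floor). [folklore] -/
theorem suN_staticPotential_le_linear (hN : 2 ≤ N) (hn : 1 ≤ n) {β : ℝ} (hβ : 0 < β) {μ : Measure (LGConfig (n + 1) (SUN N))}
    (hμ : haveI : NeZero (n + 1) := ⟨by omega⟩; μ ∈ infiniteVolumeLimitPoints (fundamentalRep (Fin N)) β) (R : ℕ) :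
    haveI : NeZero (n + 1) := ⟨by omega⟩
    staticPotential μ (fun g => normalisedCharacter N (fundamentalRep (Fin N) g)) R ≤
      (Real.log (4 * n * N / β) + 8 * n * N * β) * R := by
  haveI : NeZero (n + 1) := ⟨by omega⟩
  have hρ := TorusAreaLaw.isSpecialUnitaryModel_fundamentalRep N
  have hW := WilsonStringTension.rectExpectation_ne_zero (d := n + 1) (fundamentalRep (Fin N)) hρ hN (by omega) hβ hμ
  have hc : Continuous (fundamentalRep (Fin N) : SUN N → Matrix (Fin N) (Fin N) ℂ) := continuous_fundamentalRep (Fin N)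
  have h1 := StaticPotential.staticPotential_le_mul (fundamentalRep (Fin N)) (by omega) hc hβ.le hμ hW R
  have h2 := StaticPotential.staticPotential_le_neg_log (fundamentalRep (Fin N)) (by omega) hc hβ.le hμ hW 1
  have h3 := (suN_stringTension_le_log (n := n) hN hn hβ hμ).1
  have hR : (0 : ℝ) ≤ R := Nat.cast_nonneg R
  calc staticPotential μ (fun g => normalisedCharacter N (fundamentalRep (Fin N) g)) R
      ≤ R * staticPotential μ (fun g => normalisedCharacter N (fundamentalRep (Fin N) g)) 1 := h1
    _ ≤ R * (Real.log (4 * n * N / β) + 8 * n * N * β) := mul_le_mul_of_nonneg_left (h2.trans h3) hR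
    _ = _ := by ring

/-- **Every `N ≥ 2`, HYPOTHESIS-FREE linear FLOOR of the static potential** (dimension `n + 1 ≥ 2`, 't Hooft window `0 < β`,
`R_s = 2nβ/N ≤ 1/4`, Bakry–Émery modulus `K = 1/(1/2 − R_s)`): for every infinite-volume limit state and every `R ≥ 1`, `V_μ(R)`
exists and `V_μ(R) ≥ log((1/2 − R_s)/R_s)·R − 2·log(32N³(1/2 − R_s)/R_s)`. [cite: arXiv220412737, Lemma 4.1] -/
theorem suN_staticPotential_ge (hN : 2 ≤ N) (hn : 1 ≤ n) {β : ℝ} (hβ : 0 < β) (hR : β / N * (2 * (n : ℝ)) ≤ 1 / 4)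
    {μ : Measure (LGConfig (n + 1) (SUN N))}
    (hμ : haveI : NeZero (n + 1) := ⟨by omega⟩; μ ∈ infiniteVolumeLimitPoints (fundamentalRep (Fin N)) β) (R' : ℕ) (hR' : 1 ≤ R') :
    haveI : NeZero (n + 1) := ⟨by omega⟩
    HasStaticPotential μ (fun g => normalisedCharacter N (fundamentalRep (Fin N) g)) R'
        (staticPotential μ (fun g => normalisedCharacter N (fundamentalRep (Fin N) g)) R') ∧
      Real.log ((1 / 2 - β / N * (2 * (n : ℝ))) / (β / N * (2 * (n : ℝ)))) * R' -
          2 * Real.log (32 * (N : ℝ) ^ 3 * ((1 / 2 - β / N * (2 * (n : ℝ))) / (β / N * (2 * (n : ℝ))))) ≤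
        staticPotential μ (fun g => normalisedCharacter N (fundamentalRep (Fin N) g)) R' := by
  haveI : NeZero (n + 1) := ⟨by omega⟩
  have hN0 : (0 : ℝ) < N := by exact_mod_cast (show 0 < N by omega)
  have hn0 : (0 : ℝ) < n := by exact_mod_cast (show 0 < n by omega)
  have habs : |β / N| = β / N := abs_of_pos (div_pos hβ hN0)
  set Rs : ℝ := β / N * (2 * (n : ℝ)) with hRs
  have hRs0 : 0 < Rs := by positivity
  have hlt : Rs < 1 / 2 := by linarith
  have hpos : 0 < 1 / 2 - Rs := by linarith
  have hK : 0 ≤ 1 / (1 / 2 - Rs) := by positivity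
  have hmod := Balaban1983to89.StrongCouplingKernelWindow.oneLinkKRModulus_SU hN hlt
  have hcW : 2 * (n : ℝ) * |β / N| * (1 / (1 / 2 - Rs)) = Rs / (1 / 2 - Rs) := by rw [habs, hRs]; ring
  have hθ0 : 0 < Rs / (1 / 2 - Rs) := div_pos hRs0 hpos
  have hθ1 : Rs / (1 / 2 - Rs) ≤ 1 := by rw [div_le_one hpos]; linarith
  obtain ⟨hV, h⟩ := wilson_staticPotential_ge_explicit (n := n) hN hn hβ hK hmod (by rw [habs]) (by rw [hcW]; exact hθ1)
    hθ0 hθ1 hμ R' hR'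
  refine ⟨hV, ?_⟩
  rw [hcW, max_self] at h
  have hlog : Real.log ((1 / 2 - Rs) / Rs) = -Real.log (Rs / (1 / 2 - Rs)) := by
    rw [← Real.log_inv, inv_div]
  have hD : 32 * (N : ℝ) ^ 3 / (Rs / (1 / 2 - Rs)) = 32 * (N : ℝ) ^ 3 * ((1 / 2 - Rs) / Rs) := by
    rw [div_div_eq_mul_div]; ring
  have hlog2 : Real.log ((32 * (N : ℝ) ^ 3 * ((1 / 2 - Rs) / Rs)) ^ 2) = 2 * Real.log (32 * (N : ℝ) ^ 3 * ((1 / 2 - Rs) / Rs)) := by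
    rw [Real.log_pow]; push_cast; ring
  rw [hD, hlog2] at h
  rw [hlog]
  exact h

/-- ★★ **THE STATIC QUARK POTENTIAL OF EVERY `SU(N)` IS LINEAR UP TO CERTIFIED CONSTANTS** (`d = 4`, `N ≥ 2`, tree coupling
`0 < β ≤ N/24`, every infinite-volume limit state, every `R ≥ 1`):
`(log(N/β) − log 24)·R − 2·log(8N⁴/(3β)) ≤ V_μ(R) ≤ (log(N/β) + log 12 + 24Nβ)·R`. [folklore] -/
theorem suN_staticPotential_two_sided_dim4 (hN : 2 ≤ N) {β : ℝ} (hβ : 0 < β) (hβ1 : β ≤ N / 24)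
    {μ : Measure (LGConfig 4 (SUN N))} (hμ : μ ∈ infiniteVolumeLimitPoints (fundamentalRep (Fin N)) β) (R : ℕ) (hR : 1 ≤ R) :
    (Real.log (N / β) - Real.log 24) * R - 2 * Real.log (8 * (N : ℝ) ^ 4 / (3 * β)) ≤
        staticPotential μ (fun g => normalisedCharacter N (fundamentalRep (Fin N) g)) R ∧
      staticPotential μ (fun g => normalisedCharacter N (fundamentalRep (Fin N) g)) R ≤
        (Real.log (N / β) + Real.log 12 + 24 * N * β) * R := by
  have hN0 : (0 : ℝ) < N := by exact_mod_cast (show 0 < N by omega)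
  have hRr : (1 : ℝ) ≤ R := by exact_mod_cast hR
  set Rs : ℝ := β / N * (2 * ((3 : ℕ) : ℝ)) with hRs
  have hRs' : Rs = 6 * β / N := by rw [hRs]; push_cast; ring
  have hRs0 : 0 < Rs := by rw [hRs']; positivity
  have hRs4 : Rs ≤ 1 / 4 := by
    rw [hRs', div_le_iff₀ hN0]
    linarith
  constructor
  · obtain ⟨-, h⟩ := suN_staticPotential_ge (n := 3) hN (by norm_num) hβ hRs4 hμ R hR
    rw [← hRs] at h
    -- slope: `log((1/2 − R_s)/R_s) ≥ log(1/(4R_s)) = log(N/β) − log 24`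
    have hq : 0 < (1 / 2 - Rs) / Rs := div_pos (by linarith) hRs0
    have hslope : Real.log (N / β) - Real.log 24 ≤ Real.log ((1 / 2 - Rs) / Rs) := by
      have e1 : Real.log (N / β) - Real.log 24 = Real.log (1 / (4 * Rs)) := by
        rw [← Real.log_div (by positivity) (by norm_num), hRs']
        congr 1
        field_simp
        ring
      rw [e1]
      refine Real.log_le_log (by positivity) ?_
      rw [div_le_div_iff₀ (by positivity) hRs0]
      nlinarith
    -- intercept: `32N³(1/2 − R_s)/R_s ≤ 16N³/R_s = 8N⁴/(3β)`
    have hint : Real.log (32 * (N : ℝ) ^ 3 * ((1 / 2 - Rs) / Rs)) ≤ Real.log (8 * (N : ℝ) ^ 4 / (3 * β)) := by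
      refine Real.log_le_log (by positivity) ?_
      have e2 : 8 * (N : ℝ) ^ 4 / (3 * β) = 32 * (N : ℝ) ^ 3 * ((1 / 2) / Rs) := by
        rw [hRs']; field_simp; ring
      rw [e2]
      refine mul_le_mul_of_nonneg_left (div_le_div_of_nonneg_right (by linarith) hRs0.le) (by positivity)
    have hR0 : (0 : ℝ) ≤ R := by positivity
    nlinarith [mul_le_mul_of_nonneg_right hslope hR0]
  · have h := suN_staticPotential_le_linear (n := 3) hN (by norm_num) hβ hμ R
    push_cast at h
    have e3 : Real.log (4 * 3 * N / β) = Real.log (N / β) + Real.log 12 := by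
      rw [← Real.log_mul (by positivity) (by norm_num)]
      congr 1
      ring
    have e4 : (8 : ℝ) * 3 * N * β = 24 * N * β := by ring
    rw [e3, e4] at h
    exact h

/-- **SU(3), `d = 4`, every `β_W > 0`, every `R`: `V_μ(R) ≤ (log(108/β_W) + 24β_W)·R`** (tree coupling `β_W/3`). [folklore] -/
theorem su3_staticPotential_le_linear_dim4 {βW : ℝ} (hβ : 0 < βW) {μ : Measure (LGConfig 4 (SUN 3))}
    (hμ : μ ∈ infiniteVolumeLimitPoints (fundamentalRep (Fin 3)) (βW / 3)) (R : ℕ) :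
    staticPotential μ (fun g => normalisedCharacter 3 (fundamentalRep (Fin 3) g)) R ≤ (Real.log (108 / βW) + 24 * βW) * R := by
  have h := suN_staticPotential_le_linear (n := 3) (N := 3) (by norm_num) (by norm_num) (by positivity : 0 < βW / 3) hμ R
  push_cast at h
  have e : (4 : ℝ) * 3 * 3 / (βW / 3) = 108 / βW := by field_simp; ring
  have e' : (8 : ℝ) * 3 * 3 * (βW / 3) = 24 * βW := by ring
  rw [e, e'] at h
  exact h

end StringTensionExplicit

end Summit.Ventures.YMGap.RobustBall
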